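import Summits.ABC.ABC.Theses.IsogenyGlueCongruence
import Mathlib.NumberTheory.Primorial
import Mathlib.NumberTheory.Bertrand

/-!
# `PolyDegreeOfBoundedPrimes` (stmt-ABC-2046, crux B of route IsogenyGlueCongruence) — the abstract
strengthening is false

Negative support (cdisprove seat `refuter-cdisprove-stmt-ABC-2046-0`, 2026-08-16). Crux B reads
`DegreePrimesPolyBounded → (∃ κ C, deg φ ≤ C·N^κ)` for semistable elliptic curves over `ℚ`: bounded
prime SIZES of the modular degree should give polynomially bounded modular DEGREE. This file
certifies that the hypothesis can only be used together with arithmetic special to modular degrees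
(depth × multiplicity of congruence primes): the same implication for an ARBITRARY positive-integer
invariant `d` of the conductor is false, witnessed by `d(n) = 2ⁿ` (every prime factor is `2 ≤ 2·n⁰`,
while `2ⁿ ≤ C·n^κ` fails for large `n`).

* `exists_pow_two_gt` — `2ⁿ` outgrows `C·n^κ` for every real `κ`, `C`;
* `not_abstractPolyOfBoundedPrimes` — `¬ ∀ d, (prime factors of d n are ≤ C n^κ) → (d n ≤ C' n^κ')`;
* `two_pow_sum_range_le_primorial`, `exists_primorial_gt` — `2^{m(m−1)/2} ≤ (2^m)#` from Bertrand's
  postulate, so the primorial is superpolynomial;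
* `not_abstractPolyOfBoundedPrimes_squarefree` — the same failure with SQUAREFREE values and all
  prime factors `≤ n`: depth one and small primes still allow `n# = e^{(1+o(1))n}`; what must be
  bounded is the log-weighted number of prime factors.
-/

-- `Summit.<Summit>.<Problem>`: for the single-conjunct summit `ABC` the duplicate `ABC.ABC` is mandated.
set_option linter.dupNamespace false

namespace Summit.ABC.ABC.Theorems.PolyDegreeOfBoundedPrimes.Negative

/-- Growth lemma: `2ⁿ` is not `O(n^κ)` for any real exponent `κ` — for all `κ C : ℝ` there is
`n ≥ 1` with `C·n^κ < 2ⁿ` (round `κ` up to a natural number and use Mathlib's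
`tendsto_pow_const_div_const_pow_of_one_lt`). [folklore] -/
theorem exists_pow_two_gt (κ C : ℝ) : ∃ n : ℕ, 0 < n ∧ C * (n : ℝ) ^ κ < (2 : ℝ) ^ n := by
  set k : ℕ := ⌈κ⌉₊ with hk
  set C' : ℝ := max C 1 with hC'
  have hC'pos : 0 < C' := lt_of_lt_of_le one_pos (le_max_right _ _)
  have ht := tendsto_pow_const_div_const_pow_of_one_lt k (show (1 : ℝ) < 2 by norm_num)
  have hev : ∀ᶠ n : ℕ in Filter.atTop, (n : ℝ) ^ k / 2 ^ n < 1 / C' :=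
    ht.eventually (gt_mem_nhds (by positivity))
  obtain ⟨n, hn, hn0⟩ := (hev.and (Filter.eventually_gt_atTop 0)).exists
  refine ⟨n, hn0, ?_⟩
  have hn1 : (1 : ℝ) ≤ n := by exact_mod_cast hn0
  have hκk : κ ≤ (k : ℝ) := by rw [hk]; exact Nat.le_ceil κ
  have h1 : (n : ℝ) ^ κ ≤ (n : ℝ) ^ k := by
    rw [← Real.rpow_natCast]
    exact Real.rpow_le_rpow_of_exponent_le hn1 hκk
  have h2 : C * (n : ℝ) ^ κ ≤ C' * (n : ℝ) ^ k :=
    calc C * (n : ℝ) ^ κ ≤ C' * (n : ℝ) ^ κ :=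
          mul_le_mul_of_nonneg_right (le_max_left _ _) (Real.rpow_nonneg (by positivity) _)
      _ ≤ C' * (n : ℝ) ^ k := mul_le_mul_of_nonneg_left h1 hC'pos.le
  have h3 : (n : ℝ) ^ k * C' < 1 * 2 ^ n := by
    rwa [div_lt_div_iff₀ (by positivity) hC'pos] at hn
  linarith [h2, h3]

/-- **The abstract strengthening of crux B is false.** It is NOT true that for every invariant
`d : ℕ → ℕ` with positive values, a polynomial bound `ℓ ≤ C·n^κ` on the prime factors `ℓ` of `d n`
(`n ≥ 1`) yields a polynomial bound `d n ≤ C'·n^κ'`: take `d n = 2ⁿ`. Hence hypothesis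
`DegreePrimesPolyBounded` can enter a proof of `PolyDegreeOfBoundedPrimes` only together with a
bound on depth × multiplicity `Σ_ℓ e_ℓ log ℓ` of the prime factorisation of the modular degree,
never through the sizes of the primes alone. [folklore] -/
theorem not_abstractPolyOfBoundedPrimes :
    ¬ ∀ d : ℕ → ℕ, (∀ n, 0 < d n) →
      (∃ κ C : ℝ, ∀ n : ℕ, 0 < n → ∀ ℓ : ℕ, ℓ.Prime → ℓ ∣ d n → (ℓ : ℝ) ≤ C * (n : ℝ) ^ κ) →
      ∃ κ C : ℝ, ∀ n : ℕ, 0 < n → (d n : ℝ) ≤ C * (n : ℝ) ^ κ := by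
  intro h
  have hprimes : ∃ κ C : ℝ, ∀ n : ℕ, 0 < n → ∀ ℓ : ℕ, ℓ.Prime → ℓ ∣ 2 ^ n →
      (ℓ : ℝ) ≤ C * (n : ℝ) ^ κ := by
    refine ⟨0, 2, fun n _ ℓ hℓ hdvd => ?_⟩
    have : ℓ = 2 := (Nat.prime_dvd_prime_iff_eq hℓ Nat.prime_two).mp (hℓ.dvd_of_dvd_pow hdvd)
    subst this
    simp
  obtain ⟨κ, C, hpoly⟩ := h (fun n => 2 ^ n) (fun n => by positivity) hprimes
  obtain ⟨n, hn0, hlt⟩ := exists_pow_two_gt κ C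
  have := hpoly n hn0
  push_cast at this
  linarith

/-- Bertrand prime above `2^i`: a prime `p` with `2^i < p ≤ 2^(i+1)` (Mathlib's Bertrand postulate
`Nat.exists_prime_lt_and_le_two_mul`). [folklore] -/
theorem exists_bertrandPrime (i : ℕ) : ∃ p, Nat.Prime p ∧ 2 ^ i < p ∧ p ≤ 2 ^ (i + 1) := by
  obtain ⟨p, hp, hlt, hle⟩ := Nat.exists_prime_lt_and_le_two_mul (2 ^ i) (by positivity)
  exact ⟨p, hp, hlt, by rw [pow_succ']; exact hle⟩

/-- `2^{m(m−1)/2} ≤ (2^m)#`: Bertrand primes `p_0 < p_1 < ⋯ < p_{m−1}` with `2^i < p_i ≤ 2^{i+1}`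
are distinct primes `≤ 2^m`, so their product divides the primorial (`Finset.prod_primes_dvd`),
and it exceeds `∏ 2^i`. A poor man's Chebyshev bound, superpolynomial in `2^m`. [folklore] -/
theorem two_pow_sum_range_le_primorial (m : ℕ) :
    2 ^ (∑ i ∈ Finset.range m, i) ≤ primorial (2 ^ m) := by
  choose bp hbp using exists_bertrandPrime
  have hmono : StrictMono bp := by
    intro i j hij
    calc bp i ≤ 2 ^ (i + 1) := (hbp i).2.2
      _ ≤ 2 ^ j := Nat.pow_le_pow_right two_pos hij
      _ < bp j := (hbp j).2.1
  have hinj : Set.InjOn bp (Finset.range m : Set ℕ) := hmono.injective.injOn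
  have hdvd : ∏ p ∈ (Finset.range m).image bp, p ∣ primorial (2 ^ m) := by
    refine Finset.prod_primes_dvd _ (fun p hp => ?_) (fun p hp => ?_)
    · obtain ⟨i, -, rfl⟩ := Finset.mem_image.mp hp
      exact (hbp i).1.prime
    · obtain ⟨i, hi, rfl⟩ := Finset.mem_image.mp hp
      rw [(hbp i).1.dvd_primorial_iff]
      exact (hbp i).2.2.trans (Nat.pow_le_pow_right two_pos (Finset.mem_range.mp hi))
  have hprod : ∏ p ∈ (Finset.range m).image bp, p = ∏ i ∈ Finset.range m, bp i :=
    Finset.prod_image hinj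
  have hle : ∏ i ∈ Finset.range m, 2 ^ i ≤ ∏ i ∈ Finset.range m, bp i :=
    Finset.prod_le_prod (fun i _ => by positivity) (fun i _ => (hbp i).2.1.le)
  calc 2 ^ (∑ i ∈ Finset.range m, i) = ∏ i ∈ Finset.range m, 2 ^ i :=
        (Finset.prod_pow_eq_pow_sum _ _ _).symm
    _ ≤ ∏ i ∈ Finset.range m, bp i := hle
    _ = ∏ p ∈ (Finset.range m).image bp, p := hprod.symm
    _ ≤ primorial (2 ^ m) := Nat.le_of_dvd (primorial_pos _) hdvd

/-- The primorial is superpolynomial: for all real `κ, C` some `n ≥ 1` has `C·n^κ < n#`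
(`n = 2^m` with `(m−1)/2 ≥ κ+1` and `2^m > m ≥ C`). [folklore] -/
theorem exists_primorial_gt (κ C : ℝ) :
    ∃ n : ℕ, 0 < n ∧ C * (n : ℝ) ^ κ < (primorial n : ℝ) := by
  obtain ⟨m, hmκ, hmC, hm1⟩ : ∃ m : ℕ, 2 * κ + 3 ≤ m ∧ C ≤ m ∧ 1 ≤ m := by
    refine ⟨max (max ⌈2 * κ + 3⌉₊ ⌈C⌉₊) 1, ?_, ?_, le_max_right _ _⟩
    · calc 2 * κ + 3 ≤ ⌈2 * κ + 3⌉₊ := Nat.le_ceil _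
        _ ≤ _ := by exact_mod_cast (le_max_left _ _).trans (le_max_left _ _)
    · calc C ≤ ⌈C⌉₊ := Nat.le_ceil _
        _ ≤ _ := by exact_mod_cast (le_max_right _ _).trans (le_max_left _ _)
  refine ⟨2 ^ m, by positivity, ?_⟩
  have h2m : C < (2 : ℝ) ^ (m : ℝ) := by
    calc C ≤ m := hmC
      _ < (2 : ℝ) ^ (m : ℝ) := by
        rw [Real.rpow_natCast]; exact_mod_cast Nat.lt_two_pow_self
  have hpow : (((2 ^ m : ℕ) : ℝ)) ^ κ = (2 : ℝ) ^ ((m : ℝ) * κ) := by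
    push_cast
    rw [← Real.rpow_natCast, ← Real.rpow_mul (by norm_num)]
  have hsum : ((κ + 1) * m : ℝ) ≤ ((∑ i ∈ Finset.range m, i : ℕ) : ℝ) := by
    have h2 : ((∑ i ∈ Finset.range m, i : ℕ) : ℝ) * 2 = (m : ℝ) * (m - 1) := by
      have := Finset.sum_range_id_mul_two m
      have hm1' : ((m - 1 : ℕ) : ℝ) = (m : ℝ) - 1 := by
        rw [Nat.cast_sub hm1]; simp
      rw [← hm1']; exact_mod_cast this
    nlinarith
  have hprim : (2 : ℝ) ^ (((∑ i ∈ Finset.range m, i : ℕ) : ℝ)) ≤ (primorial (2 ^ m) : ℝ) := by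
    rw [Real.rpow_natCast]; exact_mod_cast two_pow_sum_range_le_primorial m
  have hmono : (2 : ℝ) ^ ((κ + 1) * m : ℝ) ≤ (2 : ℝ) ^ (((∑ i ∈ Finset.range m, i : ℕ) : ℝ)) :=
    Real.rpow_le_rpow_of_exponent_le (by norm_num) hsum
  have hκpos : (0 : ℝ) < (2 : ℝ) ^ ((m : ℝ) * κ) := Real.rpow_pos_of_pos two_pos _
  calc C * (((2 ^ m : ℕ) : ℝ)) ^ κ = C * (2 : ℝ) ^ ((m : ℝ) * κ) := by rw [hpow]
    _ < (2 : ℝ) ^ (m : ℝ) * (2 : ℝ) ^ ((m : ℝ) * κ) := mul_lt_mul_of_pos_right h2m hκpos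
    _ = (2 : ℝ) ^ ((κ + 1) * m : ℝ) := by
        rw [← Real.rpow_add (by norm_num)]; ring_nf
    _ ≤ (primorial (2 ^ m) : ℝ) := hmono.trans hprim

/-- **The squarefree abstract strengthening is false too.** Even for invariants with SQUAREFREE
values (multiplicity one everywhere) all of whose prime factors are `≤ n` (exponent `κ = 1`,
constant `1`), no polynomial bound follows: the primorial `n#` (`squarefree_primorial`,
`Nat.Prime.dvd_primorial_iff`, `exists_primorial_gt`). For crux B: bounding congruence DEPTHS
(`d_ℓ ≤ 1`) on top of prime SIZES is still not enough — the log-weighted NUMBER of congruence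
primes, `Σ_{ℓ ∣ deg φ} log ℓ`, must itself be `O(log N)`. [folklore] -/
theorem not_abstractPolyOfBoundedPrimes_squarefree :
    ¬ ∀ d : ℕ → ℕ, (∀ n, 0 < d n) → (∀ n, Squarefree (d n)) →
      (∀ n ℓ : ℕ, ℓ.Prime → ℓ ∣ d n → ℓ ≤ n) →
      ∃ κ C : ℝ, ∀ n : ℕ, 0 < n → (d n : ℝ) ≤ C * (n : ℝ) ^ κ := by
  intro h
  obtain ⟨κ, C, hpoly⟩ := h primorial primorial_pos squarefree_primorial
    (fun n ℓ hℓ hdvd => hℓ.dvd_primorial_iff.mp hdvd)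
  obtain ⟨n, hn0, hlt⟩ := exists_primorial_gt κ C
  exact absurd (hpoly n hn0) (not_le.mpr hlt)

end Summit.ABC.ABC.Theorems.PolyDegreeOfBoundedPrimes.Negative
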